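import Mathlib

/-!
# T5L2Positivity — the L² norm of a continuous form on a compact space vanishes iff the form does

Kernel support (blind cell pub-hodge-repro2, seat p6) for route/T5-N1-hodge-p6.md, Corollary H2.2
and §H3: «(α, α) = ‖α‖²_{L²} ≥ 0, = 0 iff α = 0» and the global form of §H5 («multiplicity-one
splitting»: for ω' = c·ω one has (ω, ω') ≠ 0 ⟺ c ≠ 0 ∧ ω ≠ 0).

Model. `S` is a compact topological space carrying a Borel measure `μ` which is finite on compacts
and positive on non-empty open sets (the volume measure `Vol_S` of a hermitian metric, Voisin
Lemma 3.8 — positivity on opens is what «Vol is a volume form» gives); a «form» is a continuous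
map `α : S → E` into a normed space (the values of the form in a fixed trivialisation; the
pointwise norm `s ↦ ‖α s‖²` is the integrand `(α, α)_s` of Voisin's (5.1)).  Nothing here is
specific to 2-forms or to complex surfaces: the statements are the measure-theoretic content of
«∫_S (α, α)_s Vol_s = 0 iff α ≡ 0», namely that a continuous non-negative integrand against a
measure of full support has integral 0 only if it vanishes identically
(Mathlib `integral_eq_zero_iff_of_nonneg` + `Continuous.ae_eq_iff_eq`).

All declarations: Mathlib only, no `sorry`, axioms ⊆ {propext, Classical.choice, Quot.sound}.
-/

namespace Summit.Ventures.HodgeRepro2.T5L2Positivity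

open MeasureTheory
open scoped InnerProductSpace

variable {S : Type*} [MeasurableSpace S] {μ : Measure S}

/-! ### Algebra of the L² pairing (no topology needed) -/

section Algebra

/-- The integral of a non-negative function is non-negative (`MeasureTheory.integral_nonneg`). -/
theorem integral_nonneg_of_nonneg {q : S → ℝ} (h0 : 0 ≤ q) : 0 ≤ ∫ s, q s ∂μ :=
  MeasureTheory.integral_nonneg h0

variable {E : Type*} [NormedAddCommGroup E] [InnerProductSpace ℂ E]

/-- **The L² self-pairing is the (real) L² norm squared**: `∫ ⟪α s, α s⟫ = ∫ ‖α s‖²` as a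
complex number (Voisin (5.1) with `β = α`; `inner_self_eq_norm_sq_to_K`). -/
theorem integral_inner_self (α : S → E) :
    ∫ s, ⟪α s, α s⟫_ℂ ∂μ = ((∫ s, ‖α s‖ ^ 2 ∂μ : ℝ) : ℂ) := by
  rw [← integral_complex_ofReal]
  congr 1
  funext s
  rw [inner_self_eq_norm_sq_to_K]
  push_cast
  rfl

/-- The L² self-pairing is real: its imaginary part is `0`. -/
theorem integral_inner_self_im (α : S → E) : (∫ s, ⟪α s, α s⟫_ℂ ∂μ).im = 0 := by
  rw [integral_inner_self]
  exact Complex.ofReal_im _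

/-- The L² self-pairing is real and non-negative (§H3, «(α, α) ≥ 0»). -/
theorem integral_inner_self_re_nonneg (α : S → E) : 0 ≤ (∫ s, ⟪α s, α s⟫_ℂ ∂μ).re := by
  rw [integral_inner_self, Complex.ofReal_re]
  exact integral_nonneg_of_nonneg fun s => by positivity

/-- **Pairing with a multiple (global §H5, the bookkeeping).** For `ω' = c • ω` pointwise,
`∫ ⟪ω, ω'⟫ = c · ∫ ‖ω‖²`. -/
theorem integral_inner_smul (α : S → E) (c : ℂ) :
    ∫ s, ⟪α s, c • α s⟫_ℂ ∂μ = c * ((∫ s, ‖α s‖ ^ 2 ∂μ : ℝ) : ℂ) := by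
  have h : (fun s => ⟪α s, c • α s⟫_ℂ) = fun s => c • ⟪α s, α s⟫_ℂ := by
    funext s
    rw [inner_smul_right, smul_eq_mul]
  rw [h, integral_smul, smul_eq_mul, integral_inner_self]

end Algebra

/-! ### Integrability and continuity on the compact space -/

variable [TopologicalSpace S] [OpensMeasurableSpace S] [CompactSpace S]
  [IsFiniteMeasureOnCompacts μ]

/-- A continuous map from a compact space into a normed group is integrable against any measure
which is finite on compacts (Voisin (5.1): the integrand `(α, β)_x` of the L² product is a
continuous function on the compact manifold). -/
theorem integrable_of_continuous {E : Type*} [NormedAddCommGroup E] {f : S → E}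
    (hf : Continuous f) : Integrable f μ :=
  hf.integrable_of_hasCompactSupport (HasCompactSupport.of_compactSpace f)

/-- The pointwise hermitian product `s ↦ ⟪α s, β s⟫` of two continuous maps is integrable. -/
theorem integrable_inner {E : Type*} [NormedAddCommGroup E] [InnerProductSpace ℂ E] {α β : S → E}
    (hα : Continuous α) (hβ : Continuous β) : Integrable (fun s => ⟪α s, β s⟫_ℂ) μ :=
  integrable_of_continuous (hα.inner hβ)

omit [MeasurableSpace S] [OpensMeasurableSpace S] [CompactSpace S] in
/-- The pointwise norm squared `s ↦ ‖α s‖ ^ 2` of a continuous map is continuous. -/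
theorem continuous_normSq {E : Type*} [NormedAddCommGroup E] {α : S → E} (hα : Continuous α) :
    Continuous fun s => ‖α s‖ ^ 2 :=
  (continuous_norm.comp hα).pow 2

/-! ### Positivity against a measure of full support -/

section OpenPos

variable [μ.IsOpenPosMeasure]

/-- **Vanishing.** For a continuous `q ≥ 0` on the compact `S` and a measure positive on open
sets, `∫ q = 0` iff `q = 0` identically: `∫ q = 0` forces `q = 0` a.e.
(`integral_eq_zero_iff_of_nonneg`), and a continuous function a.e. equal to `0` is `0`
(`Continuous.ae_eq_iff_eq`). -/
theorem integral_eq_zero_iff_of_continuous {q : S → ℝ} (hq : Continuous q) (h0 : 0 ≤ q) :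
    ∫ s, q s ∂μ = 0 ↔ q = 0 := by
  rw [integral_eq_zero_iff_of_nonneg h0 (integrable_of_continuous hq)]
  exact hq.ae_eq_iff_eq μ continuous_const

/-- **Positivity.** For a continuous `q ≥ 0`, `0 < ∫ q` iff `q` is non-zero at some point. -/
theorem integral_pos_iff_of_continuous {q : S → ℝ} (hq : Continuous q) (h0 : 0 ≤ q) :
    0 < ∫ s, q s ∂μ ↔ ∃ s, q s ≠ 0 := by
  rw [(integral_nonneg_of_nonneg (μ := μ) h0).lt_iff_ne, ne_comm, ne_eq,
    integral_eq_zero_iff_of_continuous hq h0, funext_iff]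
  simp only [Pi.zero_apply, not_forall]

/-- **H2.2/H3, «= 0 iff α = 0».** The L² norm `∫ ‖α s‖²` of a continuous map `α : S → E`
vanishes iff `α = 0`. -/
theorem integral_normSq_eq_zero_iff {E : Type*} [NormedAddCommGroup E] {α : S → E}
    (hα : Continuous α) : ∫ s, ‖α s‖ ^ 2 ∂μ = 0 ↔ α = 0 := by
  rw [integral_eq_zero_iff_of_continuous (continuous_normSq hα) (fun s => by positivity),
    funext_iff, funext_iff]
  simp only [Pi.zero_apply, pow_eq_zero_iff, ne_eq, OfNat.ofNat_ne_zero, not_false_eq_true,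
    norm_eq_zero]

/-- **H2.2/H3, «> 0 iff α ≠ 0».** -/
theorem integral_normSq_pos_iff {E : Type*} [NormedAddCommGroup E] {α : S → E}
    (hα : Continuous α) : 0 < ∫ s, ‖α s‖ ^ 2 ∂μ ↔ α ≠ 0 := by
  rw [(integral_nonneg_of_nonneg (μ := μ) (fun s => by positivity)).lt_iff_ne, ne_comm,
    ne_eq, integral_normSq_eq_zero_iff hα]

variable {E : Type*} [NormedAddCommGroup E] [InnerProductSpace ℂ E]

/-- **H2.2/H3 in the hermitian form: `∫ ⟪α, α⟫ = 0 iff α = 0`.** -/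
theorem integral_inner_self_eq_zero_iff {α : S → E} (hα : Continuous α) :
    ∫ s, ⟪α s, α s⟫_ℂ ∂μ = 0 ↔ α = 0 := by
  rw [integral_inner_self, Complex.ofReal_eq_zero, integral_normSq_eq_zero_iff hα]

/-- **H2.2/H3: `re ∫ ⟪α, α⟫ > 0 iff α ≠ 0`.** -/
theorem integral_inner_self_re_pos_iff {α : S → E} (hα : Continuous α) :
    0 < (∫ s, ⟪α s, α s⟫_ℂ ∂μ).re ↔ α ≠ 0 := by
  rw [integral_inner_self, Complex.ofReal_re, integral_normSq_pos_iff hα]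

/-- **Global §H5 (multiplicity-one splitting of the L² pairing).** If `ω' = c • ω` pointwise
(the two forms lie on one line), then `∫ ⟪ω, ω'⟫ ≠ 0 ⟺ c ≠ 0 ∧ ω ≠ 0`: for two forms on one line
the pairing is non-zero exactly when both forms are non-zero. -/
theorem integral_inner_smul_ne_zero_iff {α : S → E} (hα : Continuous α) (c : ℂ) :
    ∫ s, ⟪α s, c • α s⟫_ℂ ∂μ ≠ 0 ↔ c ≠ 0 ∧ α ≠ 0 := by
  rw [integral_inner_smul α c, mul_ne_zero_iff, Complex.ofReal_ne_zero]
  simp only [ne_eq, integral_normSq_eq_zero_iff hα]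

/-- **Global §H5, both forms on one line through a common non-zero generator.** If `ω = a • v`
and `ω' = b • v` pointwise with `v` continuous and non-zero, then `∫ ⟪ω, ω'⟫ ≠ 0 ⟺ a ≠ 0 ∧ b ≠ 0`
(= «(ω, ω') ≠ 0 ⟺ ω ≠ 0 ∧ ω' ≠ 0» of §H5). -/
theorem integral_inner_smul_smul_ne_zero_iff {v : S → E} (hv : Continuous v) (hv0 : v ≠ 0)
    (a b : ℂ) : ∫ s, ⟪a • v s, b • v s⟫_ℂ ∂μ ≠ 0 ↔ a ≠ 0 ∧ b ≠ 0 := by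
  have h : (fun s => ⟪a • v s, b • v s⟫_ℂ) = fun s => (starRingEnd ℂ) a • ⟪v s, b • v s⟫_ℂ := by
    funext s
    rw [inner_smul_left, smul_eq_mul]
  rw [h, integral_smul, smul_eq_mul, mul_ne_zero_iff, map_ne_zero,
    integral_inner_smul_ne_zero_iff hv b]
  tauto

end OpenPos

end Summit.Ventures.HodgeRepro2.T5L2Positivity
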